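import Summits.HodgeConjecture.CorCM.Model.Universe
import Summits.HodgeConjecture.CorCM.Proofs.CupC
import Summits.HodgeConjecture.CorCM.Geometry.CupFacts
import Summits.HodgeConjecture.CorCM.RationalExteriorSpan
import HarnessLib

/-!
# COR-CM fact row N2 `cup_hodge` for the model of record `Model.universeOf hHD hI hU h₃`: the complexified
# cup product in every bidegree respects the Hodge filtration, `Fᵖ Hⁱ ∪ F^q Hʲ ⊆ F^{p+q} H^{i+j}`

Cell `pub-hodgecm2`, seat model-2 (BINDER-OWNERS.md v1 row N2). The proof is the tree's
`BettiUniverse.cup2_hodge` (the equal-degree case, `HodgeTheory/BettiUniverseAxioms.lean`) written for a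
general bidegree `(i, j)`: `Fᵖ = ⨁_{a ≥ p} Θ_A⁻¹(H^{a,i-a})`, on pieces the complexified cup is the cup of the
complexifications (`ofRatClassBaseChange_cupC`, from the package's `cupC_tmul` and `ofRatClass_cupProduct`),
which is of type `(a+c, b+d)` (`BettiUniverse.cupPreservesHodgeType`), read back in the real Hodge model by
`hI`. KERNEL over `hHD`, `hI`. [Voisin I Thm. 5.29, §7.1.2]
-/

noncomputable section

open scoped TensorProduct
open CategoryTheory
open Literature.AlgebraicGeometry.Motives (bettiCohomology IsSmoothProjective ofRatClassBaseChange ofRatClassBaseChange_tmul)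
open Literature.AlgebraicGeometry.Motives
open Literature.AlgebraicTopology.SingularHomology

namespace Summit.HodgeConjecture.CorCM

namespace Model

open Literature.NumberTheory.Automorphic
open Literature.NumberTheory.Automorphic.PicardCM
open Literature.AlgebraicGeometry.HodgeTheory


/-- The complexified cup product `H^i(S(ℂ); ℂ) ⊗ H^j → H^{i+j}` of a `ℂ`-scheme `S` in bidegree `(i, j)`
(scheme-level reading of the package's `Universe.cupC` on `universeOf`: the SAME term with
`U.cup := BettiUniverse.cup`). [folklore] -/
def bettiCupC (S : SchemeOver ℂ) (i j : ℕ) :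
    ℂ ⊗[ℚ] bettiCohomology S i →ₗ[ℂ] ℂ ⊗[ℚ] bettiCohomology S j →ₗ[ℂ] ℂ ⊗[ℚ] bettiCohomology S (i + j) :=
  TensorProduct.curry (((TensorProduct.lift (BettiUniverse.cup S i j)).baseChange ℂ) ∘ₗ
    (TensorProduct.AlgebraTensorModule.distribBaseChange ℚ ℂ (bettiCohomology S i) (bettiCohomology S j)).symm.toLinearMap)

/-- `bettiCupC` on pure tensors: `(a ⊗ x) ∪ (b ⊗ y) = (ab) ⊗ (x ∪ y)`. [folklore] -/
@[simp] theorem bettiCupC_tmul (S : SchemeOver ℂ) (i j : ℕ) (a b : ℂ) (x : bettiCohomology S i)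
    (y : bettiCohomology S j) :
    bettiCupC S i j (a ⊗ₜ x) (b ⊗ₜ y) = (a * b) ⊗ₜ (BettiUniverse.cup S i j x y) := by
  simp [bettiCupC, TensorProduct.AlgebraTensorModule.distribBaseChange_symm_tmul]

/-- **Complexification is multiplicative in every bidegree**: `Θ'(x ∪ y) = Θ'(x) ∪ Θ'(y)`.
[cite: HatcherAT2002, §3.2 p. 215] -/
theorem ofRatClassBaseChange_bettiCupC (S : SchemeOver ℂ) (i j : ℕ)
    (x : ℂ ⊗[ℚ] bettiCohomology S i) (y : ℂ ⊗[ℚ] bettiCohomology S j) :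
    ofRatClassBaseChange (ComplexPoints S) (i + j) (bettiCupC S i j x y) =
      cupProduct rfl (ofRatClassBaseChange (ComplexPoints S) i x) (ofRatClassBaseChange (ComplexPoints S) j y) := by
  induction x using TensorProduct.induction_on generalizing y with
  | zero => rw [LinearMap.map_zero₂, map_zero, map_zero, LinearMap.map_zero₂]
  | tmul c a =>
    induction y using TensorProduct.induction_on with
    | zero => rw [map_zero, map_zero, map_zero, map_zero]
    | tmul c' b =>
      rw [bettiCupC_tmul, ofRatClassBaseChange_tmul, ofRatClassBaseChange_tmul, ofRatClassBaseChange_tmul,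
        LinearMap.map_smul₂, map_smul, smul_smul]
      congr 1
      exact Summit.HodgeConjecture.CorCM.Model.ofRatClass_cupProduct rfl a b
    | add y y' hy hy' => rw [map_add, map_add, hy, hy', map_add, map_add]
  | add x x' hx hx' =>
    rw [LinearMap.map_add₂, map_add, hx, hx', map_add, LinearMap.map_add₂]

/-- **`Fᵖ Hⁱ ∪ F^q Hʲ ⊆ F^{p+q} H^{i+j}`** for every smooth projective `S/ℂ` (the bidegree form of the
tree's `BettiUniverse.cup2_hodge`). [cite: VoisinHodgeI2002, §5.3.2 Thm. 5.29 and §7.1.2] -/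
theorem bettiCupC_hodge (hHD : exists_isReal_hodgeModel) (hI : hodgePQ_independent_of_hodgeModel)
    {n : ℕ} {S : SchemeOver ℂ}
    (hX : IsSmoothProjective n S) (i j : ℕ) (p q : ℤ)
    (x : ℂ ⊗[ℚ] bettiCohomology S i) (y : ℂ ⊗[ℚ] bettiCohomology S j)
    (hx : x ∈ (BettiUniverse.hodge hHD hX i).F p) (hy : y ∈ (BettiUniverse.hodge hHD hX j).F q) :
    bettiCupC S i j x y ∈ (BettiUniverse.hodge hHD hX (i + j)).F (p + q) := by
  set A := BettiUniverse.realHodgeModel hHD hX with hA_def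
  rw [BettiUniverse.hodge_F, HodgeModel.ratF_eq_iSup] at hx hy ⊢
  induction hx using Submodule.iSup_induction' generalizing y with
  | mem pq x hx =>
    by_cases hp : p ≤ (pq.1.1 : ℤ)
    · rw [iSup_pos hp] at hx
      induction hy using Submodule.iSup_induction' with
      | mem pq' y hy =>
        by_cases hq : q ≤ (pq'.1.1 : ℤ)
        · rw [iSup_pos hq] at hy
          have hab : pq.1.1 + pq.1.2 = i := Finset.HasAntidiagonal.mem_antidiagonal.1 pq.2
          have hcd : pq'.1.1 + pq'.1.2 = j := Finset.HasAntidiagonal.mem_antidiagonal.1 pq'.2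
          refine Submodule.mem_iSup_of_mem
            ⟨(pq.1.1 + pq'.1.1, pq.1.2 + pq'.1.2), Finset.HasAntidiagonal.mem_antidiagonal.2 (by omega)⟩
            (Submodule.mem_iSup_of_mem (by push_cast; omega) ?_)
          rw [HodgeModel.mem_ratPiece_iff, HodgeModel.complexification_apply] at hx hy ⊢
          rw [ofRatClassBaseChange_bettiCupC]
          have h1 : IsOfHodgeType n S i pq.1.1 pq.1.2 (ofRatClassBaseChange (ComplexPoints S) i x) := ⟨A, hx⟩
          have h2 : IsOfHodgeType n S j pq'.1.1 pq'.1.2 (ofRatClassBaseChange (ComplexPoints S) j y) := ⟨A, hy⟩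
          obtain ⟨B, hB⟩ := BettiUniverse.cupPreservesHodgeType hHD hI hX rfl h1 h2
          exact hI n S hX B A (i + j) _ _ _ hB
        · rw [iSup_neg hq, Submodule.mem_bot] at hy
          rw [hy, map_zero]
          exact Submodule.zero_mem _
      | zero => rw [map_zero]; exact Submodule.zero_mem _
      | add y y' _ _ hy hy' => rw [map_add]; exact Submodule.add_mem _ hy hy'
    · rw [iSup_neg hp, Submodule.mem_bot] at hx
      rw [hx, LinearMap.map_zero₂]
      exact Submodule.zero_mem _
  | zero => rw [LinearMap.map_zero₂]; exact Submodule.zero_mem _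
  | add x x' _ _ hx hx' => rw [LinearMap.map_add₂]; exact Submodule.add_mem _ (hx y hy) (hx' y hy)

/-- **N2 `Fact_cup_hodge`** for `universeOf` (`Universe.cupC` on `universeOf` IS `bettiCupC` on the
interpretation, definitionally). [cite: VoisinHodgeI2002, §5.3.2 Thm. 5.29 and §7.1.2] -/
theorem universeOf_fact_cup_hodge (hHD : exists_isReal_hodgeModel) (hI : hodgePQ_independent_of_hodgeModel)
    (hU : BallQuotientUniformisedDatum) (h₃ : CMAbelianVarietyRealised) : (universeOf hHD hI hU h₃).Fact_cup_hodge :=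
  fun X i j p q x y hx hy ↦ bettiCupC_hodge hHD hI (Var.isSmoothProjective hU h₃ X) i j p q x y hx hy

end Model

end Summit.HodgeConjecture.CorCM

end
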